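import Summits.CriticalPhenomena.SAWScalingLimit.Theses.SAWPhaseRetrieval
import Summits.CriticalPhenomena.SAWScalingLimit.Theorems.SAWPhaseRetrievalRetrievalStabilityDiscAlgebra
import Summits.CriticalPhenomena.SAWScalingLimit.Theorems.SAWPhaseRetrievalRetrievalStabilityDiscTile1
import Summits.CriticalPhenomena.SAWScalingLimit.Theorems.SAWPhaseRetrievalRetrievalStabilityDiscTile2
import Summits.CriticalPhenomena.SAWScalingLimit.Theorems.SAWPhaseRetrievalRetrievalStabilityDiscTile3
import Summits.CriticalPhenomena.SAWScalingLimit.Theorems.SAWPhaseRetrievalRetrievalStabilityDiscCover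
import Literature.Probability.LatticeModels.TriangularLatticeProofs
import Literature.Barriers.CriticalPhenomena.ParafermionicHalfCauchyRiemann

/-!
# Retrieval stability, disc case — the rhombus tile, IV: the tile estimate

For the proof of `SAWPhaseRetrieval.RetrievalStabilityDisc` (stmt-CriticalPhenomena-11413).
Second moment (parts II–III) `Σ λ² ≤ (2 + 100ε) ℓ_D²`, first moment (part I)
`Σ λ ≥ 2ρ(1-7ε) ℓ_D` over the `2ρ²` triangles, hence variance `≤ 128 ε ℓ_D²` about `s = ℓ_D/ρ` and,
by Cauchy–Schwarz and local isotropy, the TILE ESTIMATE: the values `‖G‖` on the `3ρ²` edges at the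
up faces of the tile deviate from `s` by at most `50 √ε ρ² s` in `ℓ¹`.
Then, from BOX data (increments and phases on the lattice box `|a|, |b| ≤ 11ρ + 2`), the tile facts
for every tile index `(P,Q)` with `max(|P|,|Q|,|P-Q|) ≤ 10` (base `(Pρ - Qρ, Qρ)`) and the COMMON
SCALE: all their reference lengths `ℓ(P,Q)` are within `700 ε ℓ(0,0)` of the central one.
-/

namespace Summit.CriticalPhenomena.SAWScalingLimit.Theorems

open Literature.Probability.LatticeModels Literature.Probability.Percolation Complex Finset


/-- The numerical inequality behind `Σ λ² ≤ (2 + 100 ε) ℓ_D²`: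
`(√3 + 18ε)(1+7ε)² ≤ (1-7ε)²(√3/2 - 3ε)(2 + 100ε)` for `0 ≤ ε ≤ 1/1000`
(at `ε = 0` both sides are `√3`; the right side grows faster). [folklore] -/
theorem rsd_numeric_sq {ε : ℝ} (hε : 0 ≤ ε) (hε1 : ε ≤ 1 / 1000) :
    (Real.sqrt 3 + 18 * ε) * (1 + 7 * ε) ^ 2 ≤
      (1 - 7 * ε) ^ 2 * (Real.sqrt 3 / 2 - 3 * ε) * (2 + 100 * ε) := by
  have hx1 : (1.732 : ℝ) < Real.sqrt 3 := by
    rw [Real.lt_sqrt (by norm_num)]; norm_num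
  have hx2 : Real.sqrt 3 < 1.7321 := by
    rw [Real.sqrt_lt' (by norm_num)]; norm_num
  set x := Real.sqrt 3 with hx
  -- RHS - LHS = ε · P with P = (22x - 24) - (468 + 700x) ε + (3024 + 2450x) ε² - 14700 ε³
  have key : (1 - 7 * ε) ^ 2 * (x / 2 - 3 * ε) * (2 + 100 * ε) - (x + 18 * ε) * (1 + 7 * ε) ^ 2 =
      ε * ((22 * x - 24) - (468 + 700 * x) * ε + (3024 + 2450 * x) * ε ^ 2 - 14700 * ε ^ 3) := by
    ring
  have hxe : x * ε ≤ 1.7321 * ε := mul_le_mul_of_nonneg_right hx2.le hε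
  have he2 : 0 ≤ (3024 + 2450 * x) * ε ^ 2 := by positivity
  have he3 : ε ^ 3 ≤ ε / 1000000 := by
    have h1 : ε ^ 2 ≤ (1 / 1000) ^ 2 := pow_le_pow_left₀ hε hε1 2
    calc ε ^ 3 = ε ^ 2 * ε := by ring
      _ ≤ (1 / 1000) ^ 2 * ε := mul_le_mul_of_nonneg_right h1 hε
      _ = ε / 1000000 := by ring
  have hP : 0 ≤ (22 * x - 24) - (468 + 700 * x) * ε + (3024 + 2450 * x) * ε ^ 2 - 14700 * ε ^ 3 := by
    nlinarith [hxe, he2, he3, hx1]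
  have := mul_nonneg hε hP
  linarith [key]

/-- **The tile estimate.** For the tile with base `(a₀, b₀)` and side `ρ ≥ 1`, given the potential
increments and phases within `ε ≤ 1/1000` of `1`, with `ℓ_D` the image length of the short
diagonal: `Σ_{s,t<ρ} (|‖G C‖ - ℓ_D/ρ| + |‖G B‖ - ℓ_D/ρ| + |‖G A‖ - ℓ_D/ρ|) ≤ 50 √ε ρ ℓ_D` over the
edges at the up faces `(![a₀+s-t, b₀+t], 0)` of the tile. [folklore] -/
theorem rsd_tile_estimate {G : Sym2 HexVertex → ℂ} {p : ℤ → ℤ → ℂ} {ε : ℝ} {a₀ b₀ : ℤ} {ρ : ℕ}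
    (hH : ∀ a b : ℤ, b₀ ≤ b → b ≤ b₀ + ρ → a₀ + b₀ ≤ a + b → a + b < a₀ + b₀ + ρ →
      p (a + 1) b - p a b = G s((![a, b], 0), (![a, b - 1], 1)))
    (hV : ∀ a b : ℤ, b₀ ≤ b → b < b₀ + ρ → a₀ + b₀ ≤ a + b → a + b < a₀ + b₀ + ρ →
      p a (b + 1) - p a b = triZeta * G s((![a, b], 0), (![a - 1, b], 1)))
    (hD : ∀ a b : ℤ, b₀ ≤ b → b < b₀ + ρ → a₀ + b₀ ≤ a + b + 1 → a + b + 1 ≤ a₀ + b₀ + ρ →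
      p a (b + 1) - p (a + 1) b = (triZeta - 1) * G s((![a, b], 0), (![a, b], 1)))
    (hPC : ∀ a b : ℤ, b₀ ≤ b → b ≤ b₀ + ρ → a₀ + b₀ ≤ a + b → a + b < a₀ + b₀ + ρ →
      ‖G s((![a, b], 0), (![a, b - 1], 1)) - ((‖G s((![a, b], 0), (![a, b - 1], 1))‖ : ℝ) : ℂ)‖ ≤ ε * ‖G s((![a, b], 0), (![a, b - 1], 1))‖)
    (hPB : ∀ a b : ℤ, b₀ ≤ b → b < b₀ + ρ → a₀ + b₀ ≤ a + b → a + b < a₀ + b₀ + ρ →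
      ‖G s((![a, b], 0), (![a - 1, b], 1)) - ((‖G s((![a, b], 0), (![a - 1, b], 1))‖ : ℝ) : ℂ)‖ ≤ ε * ‖G s((![a, b], 0), (![a - 1, b], 1))‖)
    (hPA : ∀ a b : ℤ, b₀ ≤ b → b < b₀ + ρ → a₀ + b₀ ≤ a + b + 1 → a + b + 1 ≤ a₀ + b₀ + ρ →
      ‖G s((![a, b], 0), (![a, b], 1)) - ((‖G s((![a, b], 0), (![a, b], 1))‖ : ℝ) : ℂ)‖ ≤ ε * ‖G s((![a, b], 0), (![a, b], 1))‖)
    (hε : 0 ≤ ε) (hε1 : ε ≤ 1 / 1000) (hρ : 1 ≤ ρ) :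
    ∑ s ∈ range ρ, ∑ t ∈ range ρ,
      (|‖G s((![a₀ + s - t, b₀ + t], 0), (![a₀ + s - t, b₀ + t - 1], 1))‖ - (∑ k ∈ range ρ, ‖G s((![a₀, b₀ + k], 0), (![a₀ - 1, b₀ + k], 1))‖) / ρ| +
        |‖G s((![a₀ + s - t, b₀ + t], 0), (![a₀ + s - t - 1, b₀ + t], 1))‖ - (∑ k ∈ range ρ, ‖G s((![a₀, b₀ + k], 0), (![a₀ - 1, b₀ + k], 1))‖) / ρ| +
        |‖G s((![a₀ + s - t, b₀ + t], 0), (![a₀ + s - t, b₀ + t], 1))‖ - (∑ k ∈ range ρ, ‖G s((![a₀, b₀ + k], 0), (![a₀ - 1, b₀ + k], 1))‖) / ρ|) ≤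
      50 * Real.sqrt ε * ρ * ∑ k ∈ range ρ, ‖G s((![a₀, b₀ + k], 0), (![a₀ - 1, b₀ + k], 1))‖ := by
  have hε10 : ε ≤ 1 / 10 := by linarith
  have hρR : (1 : ℝ) ≤ ρ := by exact_mod_cast hρ
  have hρ0 : (0 : ℝ) < ρ := by linarith
  set lD := ∑ k ∈ range ρ, ‖G s((![a₀, b₀ + k], 0), (![a₀ - 1, b₀ + k], 1))‖ with hlD
  have lD0 : 0 ≤ lD := Finset.sum_nonneg fun _ _ => norm_nonneg _
  set m := lD / ρ with hm
  have hm0 : 0 ≤ m := div_nonneg lD0 hρ0.le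
  have hml : lD = m * ρ := by rw [hm]; field_simp
  -- second moment
  have hQ0 := rsd_sumsq_le_boundary hH hV hD hPC hPB hPA hε hε10
  have hBd := rsd_boundary_le hH hV hD hPC hPB hPA hε hε10
  have hnum := rsd_numeric_sq hε hε1
  set Q := ∑ s ∈ range ρ, ∑ t ∈ range ρ,
    (‖G s((![a₀ + s - t, b₀ + t], 0), (![a₀ + s - t, b₀ + t - 1], 1))‖ ^ 2 + ‖G s((![a₀ + s - t - 1, b₀ + t + 1], 0), (![a₀ + s - t - 1, b₀ + t + 1 - 1], 1))‖ ^ 2) with hQdef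
  have hκ : 0 < (1 - 7 * ε) ^ 2 * (Real.sqrt 3 / 2 - 3 * ε) := by
    have : (1.7 : ℝ) ≤ Real.sqrt 3 := by
      rw [Real.le_sqrt (by norm_num) (by norm_num)]; norm_num
    have h1 : 0 < (1 - 7 * ε) ^ 2 := by nlinarith
    exact mul_pos h1 (by linarith)
  have hQ : Q ≤ (2 + 100 * ε) * lD ^ 2 := by
    have h1 : (1 - 7 * ε) ^ 2 * (Real.sqrt 3 / 2 - 3 * ε) * Q ≤
        (1 - 7 * ε) ^ 2 * (Real.sqrt 3 / 2 - 3 * ε) * ((2 + 100 * ε) * lD ^ 2) := by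
      calc _ ≤ (Real.sqrt 3 + 18 * ε) * (1 + 7 * ε) ^ 2 * lD ^ 2 := hQ0.trans hBd
        _ ≤ (1 - 7 * ε) ^ 2 * (Real.sqrt 3 / 2 - 3 * ε) * (2 + 100 * ε) * lD ^ 2 :=
            mul_le_mul_of_nonneg_right hnum (sq_nonneg _)
        _ = _ := by ring
    exact le_of_mul_le_mul_left h1 hκ
  -- first moment
  have hP0 := rsd_mean_ge hH hV hD hPC hPB hPA hε hε10
  -- the family of the `2ρ²` values
  set f : (ℕ × ℕ) × ℕ → ℝ := fun i => ‖G s((![a₀ + i.1.1 - i.1.2 - i.2, b₀ + i.1.2 + i.2], 0), (![a₀ + i.1.1 - i.1.2 - i.2, b₀ + i.1.2 + i.2 - 1], 1))‖ with hf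
  set I := (range ρ ×ˢ range ρ) ×ˢ range 2 with hI
  have hcard : (I.card : ℝ) = 2 * ρ ^ 2 := by
    rw [hI, Finset.card_product, Finset.card_product, Finset.card_range, Finset.card_range]
    push_cast; ring
  have hfQ : ∑ i ∈ I, f i ^ 2 = Q := by
    rw [hI, Finset.sum_product, hQdef, Finset.sum_product]
    refine Finset.sum_congr rfl fun s _ => Finset.sum_congr rfl fun t _ => ?_
    simp only [hf, Finset.sum_range_succ, Finset.sum_range_zero, Nat.cast_zero, sub_zero, add_zero,
      Nat.cast_one, zero_add]
  have hfP : ∑ i ∈ I, f i = ∑ t ∈ range ρ, ((∑ s ∈ range ρ, ‖G s((![a₀ + s - t, b₀ + t], 0), (![a₀ + s - t, b₀ + t - 1], 1))‖) +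
      ∑ s ∈ range ρ, ‖G s((![a₀ + s - ((t + 1 : ℕ) : ℤ), b₀ + ((t + 1 : ℕ) : ℤ)], 0), (![a₀ + s - ((t + 1 : ℕ) : ℤ), b₀ + ((t + 1 : ℕ) : ℤ) - 1], 1))‖) := by
    rw [hI, Finset.sum_product, Finset.sum_product, Finset.sum_comm]
    simp only [Finset.sum_add_distrib]
    rw [← Finset.sum_add_distrib]
    refine Finset.sum_congr rfl fun t _ => ?_
    rw [← Finset.sum_add_distrib]
    refine Finset.sum_congr rfl fun s _ => ?_
    simp only [hf, Finset.sum_range_succ, Finset.sum_range_zero, Nat.cast_zero, sub_zero, add_zero,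
      Nat.cast_one, zero_add]
    have e1 : (a₀ + (s : ℤ) - t - 1 : ℤ) = a₀ + s - ((t + 1 : ℕ) : ℤ) := by push_cast; ring
    have e2 : (b₀ + (t : ℤ) + 1 : ℤ) = b₀ + ((t + 1 : ℕ) : ℤ) := by push_cast; ring
    rw [e1, e2]
  have h2 : ∑ i ∈ I, f i ^ 2 ≤ (2 + 100 * ε) * lD ^ 2 := hfQ ▸ hQ
  have h1 : 2 * ρ * ((1 - 7 * ε) * lD) ≤ ∑ i ∈ I, f i := hfP ▸ hP0
  have hvar := rsd_l1_sq_le I f hm0 h2 h1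
  rw [hcard] at hvar
  have hvar' : (∑ i ∈ I, |f i - m|) ^ 2 ≤ (16 * ρ * lD * Real.sqrt ε) ^ 2 := by
    have hsq : Real.sqrt ε ^ 2 = ε := Real.sq_sqrt hε
    have hid : (16 * ρ * lD * Real.sqrt ε) ^ 2 = 256 * ρ ^ 2 * lD ^ 2 * ε := by
      calc (16 * ρ * lD * Real.sqrt ε) ^ 2 = 256 * ρ ^ 2 * lD ^ 2 * Real.sqrt ε ^ 2 := by ring
        _ = _ := by rw [hsq]
    have hid2 : 2 * ρ ^ 2 * ((2 + 100 * ε) * lD ^ 2 - 2 * m * (2 * ρ * ((1 - 7 * ε) * lD)) +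
        2 * ρ ^ 2 * m ^ 2) = 256 * ρ ^ 2 * lD ^ 2 * ε := by
      rw [hml]; ring
    rw [hid, ← hid2]
    exact hvar
  have hL1 : ∑ i ∈ I, |f i - m| ≤ 16 * ρ * lD * Real.sqrt ε := by
    have hnn : 0 ≤ 16 * ρ * lD * Real.sqrt ε := by positivity
    exact (abs_le_of_sq_le_sq' hvar' hnn).2
  -- the `k = 0` part of the family dominates `Σ |r_C - m|`
  have hC : ∑ s ∈ range ρ, ∑ t ∈ range ρ, |‖G s((![a₀ + s - t, b₀ + t], 0), (![a₀ + s - t, b₀ + t - 1], 1))‖ - m| ≤ ∑ i ∈ I, |f i - m| := by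
    rw [hI, Finset.sum_product, Finset.sum_product]
    refine Finset.sum_le_sum fun s _ => Finset.sum_le_sum fun t _ => ?_
    simp only [hf, Finset.sum_range_succ, Finset.sum_range_zero, Nat.cast_zero, sub_zero, add_zero,
      Nat.cast_one, zero_add]
    exact le_add_of_nonneg_right (abs_nonneg _)
  -- local isotropy at each up face
  have hloc : ∀ s ∈ range ρ, ∀ t ∈ range ρ,
      |‖G s((![a₀ + s - t, b₀ + t], 0), (![a₀ + s - t, b₀ + t - 1], 1))‖ - m| + |‖G s((![a₀ + s - t, b₀ + t], 0), (![a₀ + s - t - 1, b₀ + t], 1))‖ - m| +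
        |‖G s((![a₀ + s - t, b₀ + t], 0), (![a₀ + s - t, b₀ + t], 1))‖ - m| ≤
      (3 + 14 * ε) * |‖G s((![a₀ + s - t, b₀ + t], 0), (![a₀ + s - t, b₀ + t - 1], 1))‖ - m| + 14 * ε * m := by
    intro s hs t ht
    have hsZ : (s : ℤ) < ρ := by exact_mod_cast Finset.mem_range.1 hs
    have htZ : (t : ℤ) < ρ := by exact_mod_cast Finset.mem_range.1 ht
    set a : ℤ := a₀ + s - t with ha
    set b : ℤ := b₀ + t with hb
    have hup : G s((![a, b], 0), (![a, b - 1], 1)) + (triZeta - 1) * G s((![a, b], 0), (![a, b], 1)) - triZeta * G s((![a, b], 0), (![a - 1, b], 1)) = 0 := by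
      have e1 := hH a b (by linarith) (by linarith) (by linarith) (by linarith)
      have e2 := hD a b (by linarith) (by linarith) (by linarith) (by linarith)
      have e3 := hV a b (by linarith) (by linarith) (by linarith) (by linarith)
      linear_combination -e1 - e2 + e3
    have T := rsd_three_reals hup (hPC a b (by linarith) (by linarith) (by linarith) (by linarith))
      (hPA a b (by linarith) (by linarith) (by linarith) (by linarith))
      (hPB a b (by linarith) (by linarith) (by linarith) (by linarith))
    obtain ⟨hA', hB'⟩ := rsd_three_ref_x (norm_nonneg _) (norm_nonneg _) (norm_nonneg _) hε hε10 T
    set rC := ‖G s((![a, b], 0), (![a, b - 1], 1))‖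
    set rB := ‖G s((![a, b], 0), (![a - 1, b], 1))‖
    set rA := ‖G s((![a, b], 0), (![a, b], 1))‖
    have hrC : 0 ≤ rC := norm_nonneg _
    -- |rX - m| ≤ |rC - m| + 7 ε rC and rC ≤ m + |rC - m|
    have k1 : |rB - m| ≤ |rC - m| + 7 * ε * rC := by
      calc |rB - m| = |(rB - rC) + (rC - m)| := by ring_nf
        _ ≤ |rB - rC| + |rC - m| := abs_add_le _ _
        _ ≤ _ := by linarith
    have k2 : |rA - m| ≤ |rC - m| + 7 * ε * rC := by
      calc |rA - m| = |(rA - rC) + (rC - m)| := by ring_nf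
        _ ≤ |rA - rC| + |rC - m| := abs_add_le _ _
        _ ≤ _ := by linarith
    have k3 : rC ≤ m + |rC - m| := by have := le_abs_self (rC - m); linarith
    have k4 : 7 * ε * rC ≤ 7 * ε * (m + |rC - m|) := mul_le_mul_of_nonneg_left k3 (by linarith)
    linarith [k1, k2, k4]
  -- sum the local bound
  have hsum : ∑ s ∈ range ρ, ∑ t ∈ range ρ,
      (|‖G s((![a₀ + s - t, b₀ + t], 0), (![a₀ + s - t, b₀ + t - 1], 1))‖ - m| + |‖G s((![a₀ + s - t, b₀ + t], 0), (![a₀ + s - t - 1, b₀ + t], 1))‖ - m| +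
        |‖G s((![a₀ + s - t, b₀ + t], 0), (![a₀ + s - t, b₀ + t], 1))‖ - m|) ≤
      (3 + 14 * ε) * (∑ s ∈ range ρ, ∑ t ∈ range ρ, |‖G s((![a₀ + s - t, b₀ + t], 0), (![a₀ + s - t, b₀ + t - 1], 1))‖ - m|) +
        ρ ^ 2 * (14 * ε * m) := by
    calc _ ≤ ∑ s ∈ range ρ, ∑ t ∈ range ρ,
          ((3 + 14 * ε) * |‖G s((![a₀ + s - t, b₀ + t], 0), (![a₀ + s - t, b₀ + t - 1], 1))‖ - m| + 14 * ε * m) :=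
          Finset.sum_le_sum fun s hs => Finset.sum_le_sum fun t ht => hloc s hs t ht
      _ = _ := by
          simp only [Finset.sum_add_distrib, Finset.sum_const, Finset.card_range, nsmul_eq_mul,
            ← Finset.mul_sum]
          ring
  -- numerics: 14 ε ≤ √ε and 224 ε √ε ≤ √ε
  have hsε : ε = Real.sqrt ε * Real.sqrt ε := (Real.mul_self_sqrt hε).symm
  have hsε0 : 0 ≤ Real.sqrt ε := Real.sqrt_nonneg ε
  have hsε1 : Real.sqrt ε ≤ 1 / 31 := by
    rw [Real.sqrt_le_left (by norm_num)]; norm_num; linarith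
  have n1 : 14 * ε ≤ Real.sqrt ε := by
    have h' : Real.sqrt ε * Real.sqrt ε ≤ 1 / 31 * Real.sqrt ε := mul_le_mul_of_nonneg_right hsε1 hsε0
    rw [← hsε] at h'
    linarith
  have n2 : (3 + 14 * ε) * (16 * ρ * lD * Real.sqrt ε) ≤ 49 * Real.sqrt ε * ρ * lD := by
    have : (3 + 14 * ε) ≤ 49 / 16 := by linarith
    have h0 : 0 ≤ 16 * ρ * lD * Real.sqrt ε := by positivity
    have := mul_le_mul_of_nonneg_right this h0
    linarith
  calc _ ≤ (3 + 14 * ε) * (∑ s ∈ range ρ, ∑ t ∈ range ρ, |‖G s((![a₀ + s - t, b₀ + t], 0), (![a₀ + s - t, b₀ + t - 1], 1))‖ - m|) +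
        ρ ^ 2 * (14 * ε * m) := hsum
    _ ≤ (3 + 14 * ε) * (16 * ρ * lD * Real.sqrt ε) + ρ ^ 2 * (14 * ε * m) := by
        have h0 : 0 ≤ 3 + 14 * ε := by linarith
        have := mul_le_mul_of_nonneg_left (hC.trans hL1) h0
        linarith
    _ ≤ 49 * Real.sqrt ε * ρ * lD + ρ ^ 2 * (Real.sqrt ε * m) := by
        have : ρ ^ 2 * (14 * ε * m) ≤ ρ ^ 2 * (Real.sqrt ε * m) := by
          apply mul_le_mul_of_nonneg_left _ (by positivity)
          exact mul_le_mul_of_nonneg_right n1 hm0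
        linarith
    _ = 50 * Real.sqrt ε * ρ * lD := by rw [hml]; ring

/-- **Tile facts from box data.** For a tile index `(P,Q)` with `max(|P|,|Q|,|P-Q|) ≤ 10`, the box
data give the tile estimate `Σ |‖G‖ - ℓ/ρ| ≤ 50 √ε ρ ℓ` over the `3ρ²` edges at the up faces of the
tile and the four side bounds `|ℓ_side - ℓ| ≤ 7 ε ℓ`, `ℓ = ℓ(P,Q)`. [folklore] -/
theorem rsd_tile_facts {G : Sym2 HexVertex → ℂ} {p : ℤ → ℤ → ℂ} {ε : ℝ} {ρ : ℕ}
    (bH : ∀ a b : ℤ, |a| ≤ 11 * ρ + 1 → |b| ≤ 11 * ρ + 1 → p (a + 1) b - p a b = G s((![a, b], 0), (![a, b - 1], 1)))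
    (bV : ∀ a b : ℤ, |b| ≤ 11 * ρ + 1 → p a (b + 1) - p a b = triZeta * G s((![a, b], 0), (![a - 1, b], 1)))
    (bD : ∀ a b : ℤ, |a| ≤ 11 * ρ + 1 → |b| ≤ 11 * ρ + 1 →
      p a (b + 1) - p (a + 1) b = (triZeta - 1) * G s((![a, b], 0), (![a, b], 1)))
    (bP : ∀ a b : ℤ, |a| ≤ 11 * ρ + 2 → |b| ≤ 11 * ρ + 2 → |a + b| ≤ 11 * ρ + 2 →
      ‖G s((![a, b], 0), (![a, b - 1], 1)) - ((‖G s((![a, b], 0), (![a, b - 1], 1))‖ : ℝ) : ℂ)‖ ≤ ε * ‖G s((![a, b], 0), (![a, b - 1], 1))‖ ∧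
      ‖G s((![a, b], 0), (![a - 1, b], 1)) - ((‖G s((![a, b], 0), (![a - 1, b], 1))‖ : ℝ) : ℂ)‖ ≤ ε * ‖G s((![a, b], 0), (![a - 1, b], 1))‖ ∧
      ‖G s((![a, b], 0), (![a, b], 1)) - ((‖G s((![a, b], 0), (![a, b], 1))‖ : ℝ) : ℂ)‖ ≤ ε * ‖G s((![a, b], 0), (![a, b], 1))‖)
    (hε : 0 ≤ ε) (hε1 : ε ≤ 1 / 1000) (hρ : 1 ≤ ρ) (P Q : ℤ) (hP : |P| ≤ 10) (hQ : |Q| ≤ 10)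
    (hPQ : |P - Q| ≤ 10) :
    (∑ s ∈ range ρ, ∑ t ∈ range ρ,
      (|‖G s((![P * ρ - Q * ρ + s - t, Q * ρ + t], 0), (![P * ρ - Q * ρ + s - t, Q * ρ + t - 1], 1))‖ -
          (∑ k ∈ range ρ, ‖G s((![P * ρ - Q * ρ, Q * ρ + k], 0), (![P * ρ - Q * ρ - 1, Q * ρ + k], 1))‖) / ρ| +
        |‖G s((![P * ρ - Q * ρ + s - t, Q * ρ + t], 0), (![P * ρ - Q * ρ + s - t - 1, Q * ρ + t], 1))‖ -
          (∑ k ∈ range ρ, ‖G s((![P * ρ - Q * ρ, Q * ρ + k], 0), (![P * ρ - Q * ρ - 1, Q * ρ + k], 1))‖) / ρ| +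
        |‖G s((![P * ρ - Q * ρ + s - t, Q * ρ + t], 0), (![P * ρ - Q * ρ + s - t, Q * ρ + t], 1))‖ -
          (∑ k ∈ range ρ, ‖G s((![P * ρ - Q * ρ, Q * ρ + k], 0), (![P * ρ - Q * ρ - 1, Q * ρ + k], 1))‖) / ρ|) ≤
      50 * Real.sqrt ε * ρ * ∑ k ∈ range ρ, ‖G s((![P * ρ - Q * ρ, Q * ρ + k], 0), (![P * ρ - Q * ρ - 1, Q * ρ + k], 1))‖) ∧
    (|(∑ k ∈ range ρ, ‖G s((![P * ρ - Q * ρ + k, Q * ρ], 0), (![P * ρ - Q * ρ + k, Q * ρ - 1], 1))‖) -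
        ∑ k ∈ range ρ, ‖G s((![P * ρ - Q * ρ, Q * ρ + k], 0), (![P * ρ - Q * ρ - 1, Q * ρ + k], 1))‖| ≤
        7 * ε * ∑ k ∈ range ρ, ‖G s((![P * ρ - Q * ρ, Q * ρ + k], 0), (![P * ρ - Q * ρ - 1, Q * ρ + k], 1))‖ ∧
      |(∑ k ∈ range ρ, ‖G s((![P * ρ - Q * ρ + ρ - k - 1, Q * ρ + k], 0), (![P * ρ - Q * ρ + ρ - k - 1, Q * ρ + k], 1))‖) -
          ∑ k ∈ range ρ, ‖G s((![P * ρ - Q * ρ, Q * ρ + k], 0), (![P * ρ - Q * ρ - 1, Q * ρ + k], 1))‖| ≤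
        7 * ε * ∑ k ∈ range ρ, ‖G s((![P * ρ - Q * ρ, Q * ρ + k], 0), (![P * ρ - Q * ρ - 1, Q * ρ + k], 1))‖ ∧
      |(∑ s ∈ range ρ, ‖G s((![P * ρ - Q * ρ + s - ρ, Q * ρ + ρ], 0), (![P * ρ - Q * ρ + s - ρ, Q * ρ + ρ - 1], 1))‖) -
          ∑ k ∈ range ρ, ‖G s((![P * ρ - Q * ρ, Q * ρ + k], 0), (![P * ρ - Q * ρ - 1, Q * ρ + k], 1))‖| ≤
        7 * ε * ∑ k ∈ range ρ, ‖G s((![P * ρ - Q * ρ, Q * ρ + k], 0), (![P * ρ - Q * ρ - 1, Q * ρ + k], 1))‖ ∧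
      |(∑ k ∈ range ρ, ‖G s((![P * ρ - Q * ρ - k - 1, Q * ρ + k], 0), (![P * ρ - Q * ρ - k - 1, Q * ρ + k], 1))‖) -
          ∑ k ∈ range ρ, ‖G s((![P * ρ - Q * ρ, Q * ρ + k], 0), (![P * ρ - Q * ρ - 1, Q * ρ + k], 1))‖| ≤
        7 * ε * ∑ k ∈ range ρ, ‖G s((![P * ρ - Q * ρ, Q * ρ + k], 0), (![P * ρ - Q * ρ - 1, Q * ρ + k], 1))‖) := by
  have hε10 : ε ≤ 1 / 10 := by linarith
  have hρZ : (1 : ℤ) ≤ ρ := by exact_mod_cast hρ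
  obtain ⟨hP1, hP2⟩ := abs_le.1 hP
  obtain ⟨hQ1, hQ2⟩ := abs_le.1 hQ
  obtain ⟨hPQ1, hPQ2⟩ := abs_le.1 hPQ
  have mP1 : -(10 * (ρ : ℤ)) ≤ P * ρ := by nlinarith
  have mP2 : P * (ρ : ℤ) ≤ 10 * ρ := by nlinarith
  have mQ1 : -(10 * (ρ : ℤ)) ≤ Q * ρ := by nlinarith
  have mQ2 : Q * (ρ : ℤ) ≤ 10 * ρ := by nlinarith
  have mPQ1 : -(10 * (ρ : ℤ)) ≤ P * ρ - Q * ρ := by nlinarith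
  have mPQ2 : P * (ρ : ℤ) - Q * ρ ≤ 10 * ρ := by nlinarith
  set a₀ : ℤ := P * ρ - Q * ρ with ha₀
  set b₀ : ℤ := Q * ρ with hb₀
  -- the six tile hypotheses
  have hH : ∀ a b : ℤ, b₀ ≤ b → b ≤ b₀ + ρ → a₀ + b₀ ≤ a + b → a + b < a₀ + b₀ + ρ →
      p (a + 1) b - p a b = G s((![a, b], 0), (![a, b - 1], 1)) := fun a b h1 h2 h3 h4 =>
    bH a b (abs_le.2 ⟨by linarith, by linarith⟩) (abs_le.2 ⟨by linarith, by linarith⟩)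
  have hV : ∀ a b : ℤ, b₀ ≤ b → b < b₀ + ρ → a₀ + b₀ ≤ a + b → a + b < a₀ + b₀ + ρ →
      p a (b + 1) - p a b = triZeta * G s((![a, b], 0), (![a - 1, b], 1)) := fun a b h1 h2 _ _ =>
    bV a b (abs_le.2 ⟨by linarith, by linarith⟩)
  have hD : ∀ a b : ℤ, b₀ ≤ b → b < b₀ + ρ → a₀ + b₀ ≤ a + b + 1 → a + b + 1 ≤ a₀ + b₀ + ρ →
      p a (b + 1) - p (a + 1) b = (triZeta - 1) * G s((![a, b], 0), (![a, b], 1)) := fun a b h1 h2 h3 h4 =>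
    bD a b (abs_le.2 ⟨by linarith, by linarith⟩) (abs_le.2 ⟨by linarith, by linarith⟩)
  have hPC : ∀ a b : ℤ, b₀ ≤ b → b ≤ b₀ + ρ → a₀ + b₀ ≤ a + b → a + b < a₀ + b₀ + ρ →
      ‖G s((![a, b], 0), (![a, b - 1], 1)) - ((‖G s((![a, b], 0), (![a, b - 1], 1))‖ : ℝ) : ℂ)‖ ≤ ε * ‖G s((![a, b], 0), (![a, b - 1], 1))‖ := fun a b h1 h2 h3 h4 =>
    (bP a b (abs_le.2 ⟨by linarith, by linarith⟩) (abs_le.2 ⟨by linarith, by linarith⟩)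
      (abs_le.2 ⟨by linarith, by linarith⟩)).1
  have hPB : ∀ a b : ℤ, b₀ ≤ b → b < b₀ + ρ → a₀ + b₀ ≤ a + b → a + b < a₀ + b₀ + ρ →
      ‖G s((![a, b], 0), (![a - 1, b], 1)) - ((‖G s((![a, b], 0), (![a - 1, b], 1))‖ : ℝ) : ℂ)‖ ≤ ε * ‖G s((![a, b], 0), (![a - 1, b], 1))‖ := fun a b h1 h2 h3 h4 =>
    (bP a b (abs_le.2 ⟨by linarith, by linarith⟩) (abs_le.2 ⟨by linarith, by linarith⟩)
      (abs_le.2 ⟨by linarith, by linarith⟩)).2.1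
  have hPA : ∀ a b : ℤ, b₀ ≤ b → b < b₀ + ρ → a₀ + b₀ ≤ a + b + 1 → a + b + 1 ≤ a₀ + b₀ + ρ →
      ‖G s((![a, b], 0), (![a, b], 1)) - ((‖G s((![a, b], 0), (![a, b], 1))‖ : ℝ) : ℂ)‖ ≤ ε * ‖G s((![a, b], 0), (![a, b], 1))‖ := fun a b h1 h2 h3 h4 =>
    (bP a b (abs_le.2 ⟨by linarith, by linarith⟩) (abs_le.2 ⟨by linarith, by linarith⟩)
      (abs_le.2 ⟨by linarith, by linarith⟩)).2.2
  refine ⟨rsd_tile_estimate hH hV hD hPC hPB hPA hε hε1 hρ, ?_⟩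
  have S := rsd_sides hH hV hD hPC hPB hPA hε hε10
  exact S

/-- **Adjacent tiles have comparable scales.** If two reference lengths `ℓ, ℓ'` are both within
relative `7ε` of a common side length `X`, then `|ℓ' - ℓ| ≤ 7 ε (ℓ + ℓ')`. [folklore] -/
theorem rsd_adjacent_scales {X ℓ ℓ' ε : ℝ} (h1 : |X - ℓ| ≤ 7 * ε * ℓ) (h2 : |X - ℓ'| ≤ 7 * ε * ℓ') :
    |ℓ' - ℓ| ≤ 7 * ε * (ℓ + ℓ') := by
  have a1 := abs_le.1 h1; have a2 := abs_le.1 h2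
  rw [abs_le]; constructor <;> linarith

/-- **Common scale.** Under the box data, every tile `(P,Q)` with `max(|P|,|Q|,|P-Q|) ≤ 10` has
reference length within `700 ε` (relative) of that of the central tile:
`|ℓ(P,Q) - ℓ(0,0)| ≤ 700 ε ℓ(0,0)`.  Chain `(0,0) → (P,0) → (P,Q)` through tiles sharing a side.
[folklore] -/
theorem rsd_scales {G : Sym2 HexVertex → ℂ} {p : ℤ → ℤ → ℂ} {ε : ℝ} {ρ : ℕ}
    (bH : ∀ a b : ℤ, |a| ≤ 11 * ρ + 1 → |b| ≤ 11 * ρ + 1 → p (a + 1) b - p a b = G s((![a, b], 0), (![a, b - 1], 1)))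
    (bV : ∀ a b : ℤ, |b| ≤ 11 * ρ + 1 → p a (b + 1) - p a b = triZeta * G s((![a, b], 0), (![a - 1, b], 1)))
    (bD : ∀ a b : ℤ, |a| ≤ 11 * ρ + 1 → |b| ≤ 11 * ρ + 1 →
      p a (b + 1) - p (a + 1) b = (triZeta - 1) * G s((![a, b], 0), (![a, b], 1)))
    (bP : ∀ a b : ℤ, |a| ≤ 11 * ρ + 2 → |b| ≤ 11 * ρ + 2 → |a + b| ≤ 11 * ρ + 2 →
      ‖G s((![a, b], 0), (![a, b - 1], 1)) - ((‖G s((![a, b], 0), (![a, b - 1], 1))‖ : ℝ) : ℂ)‖ ≤ ε * ‖G s((![a, b], 0), (![a, b - 1], 1))‖ ∧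
      ‖G s((![a, b], 0), (![a - 1, b], 1)) - ((‖G s((![a, b], 0), (![a - 1, b], 1))‖ : ℝ) : ℂ)‖ ≤ ε * ‖G s((![a, b], 0), (![a - 1, b], 1))‖ ∧
      ‖G s((![a, b], 0), (![a, b], 1)) - ((‖G s((![a, b], 0), (![a, b], 1))‖ : ℝ) : ℂ)‖ ≤ ε * ‖G s((![a, b], 0), (![a, b], 1))‖)
    (hε : 0 ≤ ε) (hε1 : ε ≤ 1 / 1000) (hρ : 1 ≤ ρ) (P Q : ℤ) (hP : |P| ≤ 10) (hQ : |Q| ≤ 10)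
    (hPQ : |P - Q| ≤ 10) :
    |(∑ k ∈ range ρ, ‖G s((![P * ρ - Q * ρ, Q * ρ + k], 0), (![P * ρ - Q * ρ - 1, Q * ρ + k], 1))‖) - ∑ k ∈ range ρ, ‖G s((![0 * ρ - 0 * ρ, 0 * ρ + k], 0), (![0 * ρ - 0 * ρ - 1, 0 * ρ + k], 1))‖| ≤
      700 * ε * ∑ k ∈ range ρ, ‖G s((![0 * ρ - 0 * ρ, 0 * ρ + k], 0), (![0 * ρ - 0 * ρ - 1, 0 * ρ + k], 1))‖ := by
  set ℓ : ℤ → ℤ → ℝ := fun P Q => ∑ k ∈ range ρ, ‖G s((![P * ρ - Q * ρ, Q * ρ + k], 0), (![P * ρ - Q * ρ - 1, Q * ρ + k], 1))‖ with hℓ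
  have ℓ0 : ∀ P Q, 0 ≤ ℓ P Q := fun P Q => Finset.sum_nonneg fun _ _ => norm_nonneg _
  have facts := fun P Q hP hQ hPQ => (rsd_tile_facts bH bV bD bP hε hε1 hρ P Q hP hQ hPQ).2
  -- steps in the `P` direction (shared right/left side)
  have stepP : ∀ P Q : ℤ, |P| ≤ 10 → |Q| ≤ 10 → |P - Q| ≤ 10 → |P + 1| ≤ 10 → |P + 1 - Q| ≤ 10 →
      |ℓ (P + 1) Q - ℓ P Q| ≤ 7 * ε * (ℓ P Q + ℓ (P + 1) Q) := by
    intro P Q hP hQ hPQ hP' hPQ'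
    obtain ⟨-, hR, -, -⟩ := facts P Q hP hQ hPQ
    obtain ⟨-, -, -, hL⟩ := facts (P + 1) Q hP' hQ hPQ'
    have e : (∑ k ∈ range ρ, ‖G s((![(P + 1) * ρ - Q * ρ - k - 1, Q * ρ + k], 0), (![(P + 1) * ρ - Q * ρ - k - 1, Q * ρ + k], 1))‖) =
        ∑ k ∈ range ρ, ‖G s((![P * ρ - Q * ρ + ρ - k - 1, Q * ρ + k], 0), (![P * ρ - Q * ρ + ρ - k - 1, Q * ρ + k], 1))‖ := by
      refine Finset.sum_congr rfl fun k _ => ?_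
      have : ((P + 1) * ρ - Q * ρ - k - 1 : ℤ) = P * ρ - Q * ρ + ρ - k - 1 := by ring
      rw [this]
    rw [e] at hL
    exact rsd_adjacent_scales hR hL
  -- steps in the `Q` direction (shared top/bottom side)
  have stepQ : ∀ P Q : ℤ, |P| ≤ 10 → |Q| ≤ 10 → |P - Q| ≤ 10 → |Q + 1| ≤ 10 → |P - (Q + 1)| ≤ 10 →
      |ℓ P (Q + 1) - ℓ P Q| ≤ 7 * ε * (ℓ P Q + ℓ P (Q + 1)) := by
    intro P Q hP hQ hPQ hQ' hPQ'
    obtain ⟨-, -, hT, -⟩ := facts P Q hP hQ hPQ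
    obtain ⟨hB, -, -, -⟩ := facts P (Q + 1) hP hQ' hPQ'
    have e : (∑ k ∈ range ρ, ‖G s((![P * ρ - (Q + 1) * ρ + k, (Q + 1) * ρ], 0), (![P * ρ - (Q + 1) * ρ + k, (Q + 1) * ρ - 1], 1))‖) =
        ∑ s ∈ range ρ, ‖G s((![P * ρ - Q * ρ + s - ρ, Q * ρ + ρ], 0), (![P * ρ - Q * ρ + s - ρ, Q * ρ + ρ - 1], 1))‖ := by
      refine Finset.sum_congr rfl fun k _ => ?_
      have e1 : (P * ρ - (Q + 1) * ρ + k : ℤ) = P * ρ - Q * ρ + k - ρ := by ring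
      have e2 : ((Q + 1) * ρ : ℤ) = Q * ρ + ρ := by ring
      rw [e1, e2]
    rw [e] at hB
    exact rsd_adjacent_scales hT hB
  obtain ⟨hP1, hP2⟩ := abs_le.1 hP
  obtain ⟨hQ1, hQ2⟩ := abs_le.1 hQ
  obtain ⟨hPQ1, hPQ2⟩ := abs_le.1 hPQ
  -- chain 1: (0,0) → (P,0)
  have c1 : |ℓ P 0 - ℓ 0 0| ≤ 300 * ε * ℓ 0 0 := by
    refine rsd_line_chain (fun j => ℓ j 0) (lo := -10) (hi := 10) (by norm_num) (by norm_num)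
      (by norm_num) (by norm_num) hε hε1 (fun j _ _ => ℓ0 j 0) ?_ P hP1 hP2
    intro j hj1 hj2
    exact stepP j 0 (abs_le.2 ⟨hj1, by linarith⟩) (by norm_num) (by simp; exact abs_le.2 ⟨hj1, by linarith⟩)
      (abs_le.2 ⟨by linarith, by linarith⟩) (by simp; exact abs_le.2 ⟨by linarith, by linarith⟩)
  -- chain 2: (P,0) → (P,Q), inside `[max(-10, P-10), min(10, P+10)]`
  have c2 : |ℓ P Q - ℓ P 0| ≤ 300 * ε * ℓ P 0 := by
    refine rsd_line_chain (fun j => ℓ P j) (lo := max (-10) (P - 10)) (hi := min 10 (P + 10))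
      (le_max_left _ _) (max_le (by norm_num) (by linarith)) (le_min (by norm_num) (by linarith))
      (min_le_left _ _) hε hε1 (fun j _ _ => ℓ0 P j) ?_ Q (max_le hQ1 (by linarith))
      (le_min hQ2 (by linarith))
    intro j hj1 hj2
    have hj1' := le_max_left (-10 : ℤ) (P - 10) |>.trans hj1
    have hj1'' := le_max_right (-10 : ℤ) (P - 10) |>.trans hj1
    have hj2' := hj2.trans_le (min_le_left 10 (P + 10))
    have hj2'' := hj2.trans_le (min_le_right 10 (P + 10))
    exact stepQ P j hP (abs_le.2 ⟨hj1', hj2'.le⟩) (abs_le.2 ⟨by linarith, by linarith⟩)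
      (abs_le.2 ⟨by linarith, by linarith⟩) (abs_le.2 ⟨by linarith, by linarith⟩)
  -- combine
  have l00 := ℓ0 0 0
  have a1 := abs_le.1 c1
  have a2 := abs_le.1 c2
  have h03 : 300 * ε * ℓ 0 0 ≤ 0.3 * ℓ 0 0 := mul_le_mul_of_nonneg_right (by linarith) l00
  have hb : ℓ P 0 ≤ 1.3 * ℓ 0 0 := by linarith
  have hc : 300 * ε * ℓ P 0 ≤ 300 * ε * (1.3 * ℓ 0 0) := mul_le_mul_of_nonneg_left hb (by positivity)
  have key : |ℓ P Q - ℓ 0 0| ≤ 700 * ε * ℓ 0 0 := by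
    rw [abs_le]; constructor <;> nlinarith
  simpa [hℓ] using key

end Summit.CriticalPhenomena.SAWScalingLimit.Theorems
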